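import Mathlib
import Summits.ValiantsHypothesis.ValiantsHypothesis.Theorems.LiouvilleSarnakCutRankAlignedWindow
import Summits.ValiantsHypothesis.ValiantsHypothesis.Theorems.LiouvilleSarnakLiouvilleCutRankDefectiveTarget

/-!
# Route LiouvilleSarnak — crux `LiouvilleCutRank` (stmt-ValiantsHypothesis-14775):
# anti-aligned windows `C^L R^L` with `≤ d` wrong letters

The orientation companion of `…DefectiveWindow.le_rank_of_defectiveAlignedWindow` (`R^L C^L` up to `d`
defects), obtained from the general `…DefectiveTarget.le_rank_of_defectiveTarget` with the target
`k ↦ [L ≤ k]` and the exact class `CutRankAlignedWindow.le_rank_of_antiAlignedWindow`: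

* `card_range_filter_le_iff` — counting the two halves of the target.
* ★ `le_rank_of_defectiveAntiAlignedWindow` — for all `W, d` there is `L` such that at every level, every cut
  with a window `[s, s+2L)` carrying at most `d` column bits in its second half plus row bits in its first
  half has Liouville cut-matrix rank `≥ W`.

Honest framing: bookkeeping; `LiouvilleCutRank`, `DigitalBilinearLiouville`, `AlgebraicSarnak` stay OPEN;
nothing bears on `VP ≠ VNP`.  No definitions.
-/

set_option linter.dupNamespace false

noncomputable section

namespace Summit.ValiantsHypothesis.ValiantsHypothesis.Theorems.LiouvilleSarnakLiouvilleCutRank.DefectiveTarget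

open ArithmeticFunction Finset

open Summit.ValiantsHypothesis.ValiantsHypothesis.Theorems.LiouvilleSarnakCutRankAlignedWindow
  (le_rank_of_antiAlignedWindow)

/-- Among `k < 2L`, those with `L ≤ k` (resp. `k < L`) number at most `L`. [folklore] -/
theorem card_range_filter_le_iff (L : ℕ) (b : Bool) :
    ((range (2 * L)).filter fun k => decide (L ≤ k) = b).card ≤ L := by
  cases b
  · have hsub : ((range (2 * L)).filter fun k => decide (L ≤ k) = false) ⊆ range L := by
      intro k hk
      rw [mem_filter, mem_range, decide_eq_false_iff_not] at hk
      rw [mem_range]; omega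
    exact (card_le_card hsub).trans (by rw [card_range])
  · have hsub : ((range (2 * L)).filter fun k => decide (L ≤ k) = true) ⊆
        (range L).image fun i => L + i := by
      intro k hk
      rw [mem_filter, mem_range, decide_eq_true_eq] at hk
      exact mem_image.mpr ⟨k - L, mem_range.mpr (by omega), by omega⟩
    exact (card_le_card hsub).trans (card_image_le.trans (by rw [card_range]))

/-- ★ **`C^L R^L` up to `d` wrong letters.**  For all `W, d` there is `L` such that at every level `n`, every
cut with a window `[s, s+2L)` carrying at most `d` defects with respect to the anti-aligned pattern (column
bits at offsets `< L`, row bits at offsets `≥ L`) — i.e. at most `d` column bits in the second half plus row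
bits in the first half — has Liouville cut-matrix rank `≥ W`. [this file] -/
theorem le_rank_of_defectiveAntiAlignedWindow (W d : ℕ) : ∃ L : ℕ, ∀ (n : ℕ)
    (π : Fin n ⊕ Fin n ≃ Fin (2 * n)) (s : ℕ), s + 2 * L ≤ 2 * n →
    (univ.filter fun j : Fin n => s ≤ (π (Sum.inr j) : ℕ) ∧ (π (Sum.inr j) : ℕ) < s + 2 * L ∧
        decide (L ≤ (π (Sum.inr j) : ℕ) - s) = true).card +
      (univ.filter fun i : Fin n => s ≤ (π (Sum.inl i) : ℕ) ∧ (π (Sum.inl i) : ℕ) < s + 2 * L ∧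
        decide (L ≤ (π (Sum.inl i) : ℕ) - s) = false).card ≤ d →
    W ≤ (Matrix.of fun r c : Fin n → Bool =>
      (((liouville (Nat.ofBits (fun k : Fin (2 * n) => Sum.elim r c (π.symm k)) + 1) : ℤ) :
        ℂ))).rank := by
  obtain ⟨L, hL⟩ := le_rank_of_antiAlignedWindow (4 ^ d * W)
  refine ⟨L, fun n π s hs hdef => ?_⟩
  have hLn : L ≤ n := by omega
  refine le_rank_of_defectiveTarget s (2 * L) d W (fun k => decide (L ≤ k))
    ((card_range_filter_le_iff L true).trans hLn)
    ((card_range_filter_le_iff L false).trans hLn)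
    (fun π' hπ' => hL n π' s hs ?_ ?_) π hdef
  · intro j hj1 hj2
    rw [hπ' j hj1 (by omega), decide_eq_false_iff_not]
    omega
  · intro j hj1 hj2
    rw [hπ' j (by omega) hj2, decide_eq_true_eq]
    omega

end Summit.ValiantsHypothesis.ValiantsHypothesis.Theorems.LiouvilleSarnakLiouvilleCutRank.DefectiveTarget

end
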